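import Mathlib
import HarnessLib
import Summits.NavierStokesRegularity.NavierStokesRegularity.Theorems.PoloidalWindowDoorPoloidalWindowRigidityWeightedIBP

/-!
# Weighted Young / Cauchy–Schwarz inequalities for kernel representations `u = Σⱼ Rⱼ ⋆ gⱼ` against the weight `ρ_σ`

Seat ns-poloidal-K2-p2 g6 (interim lead-of-record on crux K2 `PoloidalWindowRigidity` = stmt-NavierStokesRegularity-19708;
line `mixed_type` v1; item stmt-20428 `LrcModEntire`).  File 3 (of 5) of the Lean port of **Theorem A** of memo TH-ELLIPTIC-LIOUVILLE-g6
(semi-elliptic (TH) Liouville without slope bounds): the FOURIER-FREE half of the «reverse Bernstein inequality».  The 1-D core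
(`…VerticalConvexity`, p571291) consumes at every height a reverse inequality `∫ u² ≤ C ∫ g²` (weighted); for the frequency-localised
field `u = w ∗ φ` it comes from a kernel representation `u = Σⱼ Rⱼ ⋆ ∂ⱼu` (`Rⱼ` Schwartz — the Fourier side, file 4) and the
elementary estimates proved here for the weight `ρ_σ = weight σ` of `…WeightedIBP` (p572071):

* `one_add_norm_sq_le`, `weight_add_le` — PEETRE: `ρ_σ(x + y) ≤ 4(1 + ‖y‖²)² ρ_σ(x)` for `σ ≥ 1`;
* `sq_integral_mul_le` — Cauchy–Schwarz against an `L¹` kernel: `(∫ R·k)² ≤ ‖R‖₁ · ∫ |R| k²` (quadratic-form proof, no Hölder);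
* `integral_integral_kernel_mul_weight_le` — TONELLI + PEETRE: `∫ₓ (∫_y |R(y)| h(x−y) dy) ρ_σ(x) dx ≤ 4·(∫|R|(1+‖y‖²)²)·∫ h ρ_σ` for bounded
  continuous `h ≥ 0` (`dim E < 4` for the integrability of `ρ_σ`);
* `integral_convSq_mul_weight_le` — both combined for ONE kernel: `∫ (∫ R(y) g(x−y) dy)² ρ_σ(x) dx ≤ 4 ‖R‖₁ M_R ∫ g² ρ_σ`
  (`M_R = ∫ |R|(1+‖y‖²)²`) — the per-kernel form of the reverse inequality `hrev` of the core; the finite sum over `j`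
  (`u = Σⱼ Rⱼ ⋆ ∂ⱼu`, `Σⱼ (∂ⱼu)² = ‖∇u‖²`) is left to the assembly file.

WHAT THIS IS NOT: not a claim about Navier–Stokes — weighted measure theory on `ℝᵈ` (bears_on LADDER-NS N0 via crux K2 = stmt-19708 / item 20428).
-/

-- the summit and its single sub-problem share the name (CONVENTIONS §1)
set_option linter.dupNamespace false

noncomputable section

namespace Summit.NavierStokesRegularity.NavierStokesRegularity.Theorems.PoloidalWindowDoorPoloidalWindowRigidityWeightedYoung

open Set Function Filter Topology MeasureTheory
open scoped RealInnerProductSpace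
open Summit.NavierStokesRegularity.NavierStokesRegularity.Theorems.PoloidalWindowDoorPoloidalWindowRigidityWeightedIBP

variable {E : Type*} [NormedAddCommGroup E]

/-! ### Peetre's inequality for the weight -/

/-- Peetre: `1 + ‖a‖² ≤ 2 (1 + ‖a − b‖²)(1 + ‖b‖²)`. [folklore] -/
theorem one_add_norm_sq_le (a b : E) : 1 + ‖a‖ ^ 2 ≤ 2 * (1 + ‖a - b‖ ^ 2) * (1 + ‖b‖ ^ 2) := by
  have h1 : ‖a‖ ≤ ‖a - b‖ + ‖b‖ := by
    have := norm_add_le (a - b) b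
    simpa using this
  have h2 : ‖a‖ ^ 2 ≤ 2 * ‖a - b‖ ^ 2 + 2 * ‖b‖ ^ 2 := by
    nlinarith [norm_nonneg a, norm_nonneg (a - b), norm_nonneg b, sq_nonneg (‖a - b‖ - ‖b‖)]
  nlinarith [sq_nonneg ‖a - b‖, sq_nonneg ‖b‖, mul_nonneg (sq_nonneg ‖a - b‖) (sq_nonneg ‖b‖)]

variable [InnerProductSpace ℝ E]

/-- **PEETRE FOR `ρ_σ`**: `ρ_σ(x + y) ≤ 4 (1 + ‖y‖²)² ρ_σ(x)` for `σ ≥ 1`. [folklore] -/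
theorem weight_add_le {σ : ℝ} (hσ : 1 ≤ σ) (x y : E) :
    weight σ (x + y) ≤ 4 * (1 + ‖y‖ ^ 2) ^ 2 * weight σ x := by
  have hσ0 : 0 < σ := lt_of_lt_of_le one_pos hσ
  have hσ2 : 1 ≤ σ ^ 2 := by nlinarith
  set Bx : ℝ := 1 + ‖x‖ ^ 2 / σ ^ 2 with hBx
  set Bxy : ℝ := 1 + ‖x + y‖ ^ 2 / σ ^ 2 with hBxy
  have hBx0 : 0 < Bx := weightBase_pos σ x
  have hBxy0 : 0 < Bxy := weightBase_pos σ (x + y)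
  -- Peetre with `a = x/σ`, `b = -y/σ` (so `a - b = (x+y)/σ`)
  have hP := one_add_norm_sq_le (σ⁻¹ • x) (-(σ⁻¹ • y))
  have e1 : ‖σ⁻¹ • x‖ ^ 2 = ‖x‖ ^ 2 / σ ^ 2 := by
    rw [norm_smul, Real.norm_eq_abs, abs_inv, abs_of_pos hσ0, mul_pow, inv_pow]; ring
  have e2 : ‖σ⁻¹ • x - -(σ⁻¹ • y)‖ ^ 2 = ‖x + y‖ ^ 2 / σ ^ 2 := by
    rw [sub_neg_eq_add, ← smul_add, norm_smul, Real.norm_eq_abs, abs_inv, abs_of_pos hσ0, mul_pow, inv_pow]; ring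
  have e3 : ‖-(σ⁻¹ • y)‖ ^ 2 = ‖y‖ ^ 2 / σ ^ 2 := by
    rw [norm_neg, norm_smul, Real.norm_eq_abs, abs_inv, abs_of_pos hσ0, mul_pow, inv_pow]; ring
  rw [e1, e2, e3] at hP
  have hy : ‖y‖ ^ 2 / σ ^ 2 ≤ ‖y‖ ^ 2 := div_le_self (sq_nonneg _) hσ2
  have hP' : Bx ≤ 2 * Bxy * (1 + ‖y‖ ^ 2) := by
    calc Bx ≤ 2 * Bxy * (1 + ‖y‖ ^ 2 / σ ^ 2) := hP
      _ ≤ 2 * Bxy * (1 + ‖y‖ ^ 2) := by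
          apply mul_le_mul_of_nonneg_left _ (by positivity); linarith
  show (Bxy ^ 2)⁻¹ ≤ 4 * (1 + ‖y‖ ^ 2) ^ 2 * (Bx ^ 2)⁻¹
  rw [inv_eq_one_div, inv_eq_one_div, mul_one_div, div_le_div_iff₀ (pow_pos hBxy0 2) (pow_pos hBx0 2), one_mul]
  calc Bx ^ 2 ≤ (2 * Bxy * (1 + ‖y‖ ^ 2)) ^ 2 := pow_le_pow_left₀ hBx0.le hP' 2
    _ = 4 * (1 + ‖y‖ ^ 2) ^ 2 * Bxy ^ 2 := by ring

/-! ### Cauchy–Schwarz against an `L¹` kernel (elementary form) -/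

section CS

variable [MeasurableSpace E] {μ : Measure E}

omit [NormedAddCommGroup E] [InnerProductSpace ℝ E] in
/-- **Cauchy–Schwarz against a kernel**: for `R ∈ L¹` and `k` bounded measurable,
`(∫ R·k)² ≤ (∫ |R|) · ∫ |R| k²`.  Proof: `0 ≤ ∫ |R| (|k| − t)²` for every `t`, then optimise in `t`. [folklore] -/
theorem sq_integral_mul_le {R k : E → ℝ} (hR : Integrable R μ) (hk : AEStronglyMeasurable k μ) {K : ℝ}
    (hkK : ∀ y, |k y| ≤ K) :
    (∫ y, R y * k y ∂μ) ^ 2 ≤ (∫ y, |R y| ∂μ) * ∫ y, |R y| * k y ^ 2 ∂μ := by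
  have iR : Integrable (fun y => |R y|) μ := hR.abs
  have iRk : Integrable (fun y => |R y| * |k y|) μ := by
    refine (iR.mul_const K).mono' (iR.aestronglyMeasurable.mul (continuous_abs.comp_aestronglyMeasurable hk))
      (Eventually.of_forall fun y => ?_)
    rw [Real.norm_eq_abs, abs_mul, abs_abs, abs_abs]
    exact mul_le_mul_of_nonneg_left (hkK y) (abs_nonneg _)
  have iRk2 : Integrable (fun y => |R y| * k y ^ 2) μ := by
    refine (iR.mul_const (K ^ 2)).mono' (iR.aestronglyMeasurable.mul (hk.pow 2)) (Eventually.of_forall fun y => ?_)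
    rw [Real.norm_eq_abs, abs_mul, abs_abs, abs_pow]
    exact mul_le_mul_of_nonneg_left (pow_le_pow_left₀ (abs_nonneg _) (hkK y) 2) (abs_nonneg _)
  set A := ∫ y, |R y| ∂μ with hA
  set B := ∫ y, |R y| * |k y| ∂μ with hB
  set C := ∫ y, |R y| * k y ^ 2 ∂μ with hC
  have hA0 : 0 ≤ A := integral_nonneg fun y => abs_nonneg _
  -- `|∫ R k| ≤ B`
  have h1 : |∫ y, R y * k y ∂μ| ≤ B := by
    calc |∫ y, R y * k y ∂μ| ≤ ∫ y, |R y * k y| ∂μ := abs_integral_le_integral_abs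
      _ = B := by simp only [hB, abs_mul]
  -- the quadratic form: `0 ≤ C − 2tB + t²A` for all `t`
  have hq : ∀ t : ℝ, 0 ≤ C - 2 * t * B + t ^ 2 * A := by
    intro t
    have h0 : 0 ≤ ∫ y, |R y| * (|k y| - t) ^ 2 ∂μ := integral_nonneg fun y => mul_nonneg (abs_nonneg _) (sq_nonneg _)
    have he : ∫ y, |R y| * (|k y| - t) ^ 2 ∂μ = C - 2 * t * B + t ^ 2 * A := by
      have e1 : (fun y => |R y| * (|k y| - t) ^ 2) =
          fun y => |R y| * k y ^ 2 - 2 * t * (|R y| * |k y|) + t ^ 2 * |R y| := by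
        funext y; rw [← sq_abs (k y)]; ring
      have i1 : Integrable (fun y => |R y| * k y ^ 2 - 2 * t * (|R y| * |k y|)) μ := iRk2.sub (iRk.const_mul _)
      have i2 : Integrable (fun y => t ^ 2 * |R y|) μ := iR.const_mul _
      have i3 : Integrable (fun y => 2 * t * (|R y| * |k y|)) μ := iRk.const_mul _
      rw [e1, integral_add i1 i2, integral_sub iRk2 i3, integral_const_mul, integral_const_mul]
    rw [he] at h0; exact h0
  -- `B² ≤ A C`
  have hBAC : B ^ 2 ≤ A * C := by
    rcases eq_or_lt_of_le hA0 with hA0' | hApos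
    · -- `A = 0`: then `|R| = 0` a.e., so `B = 0`
      have hR0 : (fun y => |R y|) =ᵐ[μ] 0 := (integral_eq_zero_iff_of_nonneg (fun y => abs_nonneg _) iR).1 hA0'.symm
      have hB0 : B = 0 := by
        rw [hB]
        refine integral_eq_zero_of_ae (hR0.mono fun y hy => ?_)
        simp only [Pi.zero_apply] at hy
        simp [hy]
      rw [hB0, ← hA0']; simp
    · have h := hq (B / A)
      have e : C - 2 * (B / A) * B + (B / A) ^ 2 * A = C - B ^ 2 / A := by field_simp; ring
      rw [e] at h
      have h' : B ^ 2 / A ≤ C := by linarith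
      rwa [div_le_iff₀ hApos, mul_comm] at h'
  calc (∫ y, R y * k y ∂μ) ^ 2 = |∫ y, R y * k y ∂μ| ^ 2 := (sq_abs _).symm
    _ ≤ B ^ 2 := pow_le_pow_left₀ (abs_nonneg _) h1 2
    _ ≤ A * C := hBAC

end CS

/-! ### Tonelli + Peetre -/

section Tonelli

variable [FiniteDimensional ℝ E] [MeasurableSpace E] [BorelSpace E]

/-- **TONELLI + PEETRE**: for `R ∈ L¹` with finite `(1+‖y‖²)²`-moment and `h ≥ 0` bounded continuous, `σ ≥ 1`, `dim E < 4`: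
`∫ₓ (∫_y |R(y)| h(x−y) dy) ρ_σ(x) dx ≤ 4 (∫ |R(y)|(1+‖y‖²)² dy) ∫ h ρ_σ`. [folklore] -/
theorem integral_integral_kernel_mul_weight_le {σ : ℝ} (hσ : 1 ≤ σ) (hE : Module.finrank ℝ E < 4) {R h : E → ℝ}
    (hR : Integrable R) (hRm : Integrable fun y => |R y| * (1 + ‖y‖ ^ 2) ^ 2) (hc : Continuous h)
    (h0 : ∀ x, 0 ≤ h x) {H : ℝ} (hH : ∀ x, h x ≤ H) :
    ∫ x, (∫ y, |R y| * h (x - y)) * weight σ x ≤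
      4 * (∫ y, |R y| * (1 + ‖y‖ ^ 2) ^ 2) * ∫ x, h x * weight σ x := by
  have hσ0 : 0 < σ := lt_of_lt_of_le one_pos hσ
  have iρ : Integrable (weight (E := E) σ) := integrable_weight hσ0 hE
  have ρ0 : ∀ x : E, 0 < weight σ x := weight_pos σ
  have hHabs : ∀ x, |h x| ≤ H := fun x => by rw [abs_of_nonneg (h0 x)]; exact hH x
  set I : ℝ := ∫ x, h x * weight σ x with hI
  -- the product integrand and its integrability on `E × E`
  set G : E × E → ℝ := fun p => |R p.2| * h (p.1 - p.2) * weight σ p.1 with hG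
  have hRabs : AEStronglyMeasurable (fun y => |R y|) (volume : Measure E) := hR.abs.aestronglyMeasurable
  have hGm : AEStronglyMeasurable G ((volume : Measure E).prod volume) :=
    ((hRabs.comp_snd (μ := (volume : Measure E))).mul
      (hc.comp (continuous_fst.sub continuous_snd)).aestronglyMeasurable).mul
      (continuous_weight.comp continuous_fst).aestronglyMeasurable
  have hGi : Integrable G (volume.prod volume) := by
    have hprod : Integrable (fun p : E × E => weight σ p.1 * |R p.2|) (volume.prod volume) :=
      iρ.mul_prod hR.abs
    refine (hprod.const_mul H).mono' hGm (Eventually.of_forall fun p => ?_)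
    rw [Real.norm_eq_abs, hG]
    simp only [abs_mul, abs_abs, abs_of_pos (ρ0 _)]
    calc |R p.2| * |h (p.1 - p.2)| * weight σ p.1 ≤ |R p.2| * H * weight σ p.1 :=
          mul_le_mul_of_nonneg_right (mul_le_mul_of_nonneg_left (hHabs _) (abs_nonneg _)) (ρ0 _).le
      _ = H * (weight σ p.1 * |R p.2|) := by ring
  -- rewrite the left-hand side as an iterated integral of `G` and swap the order
  have e1 : (fun x => (∫ y, |R y| * h (x - y)) * weight σ x) = fun x => ∫ y, G (x, y) := by
    funext x
    rw [← integral_mul_const]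
  rw [e1, integral_integral_swap (f := fun x y => G (x, y)) hGi]
  -- the inner `x`-integral, for fixed `y`: translate and apply Peetre
  have hinner : ∀ y, ∫ x, G (x, y) ≤ |R y| * (1 + ‖y‖ ^ 2) ^ 2 * (4 * I) := by
    intro y
    have e2 : (fun x => G (x, y)) = fun x => |R y| * (h (x - y) * weight σ x) := by
      funext x; simp only [hG]; ring
    rw [e2, integral_const_mul, mul_assoc]
    refine mul_le_mul_of_nonneg_left ?_ (abs_nonneg _)
    -- `∫ h(x−y) ρ(x) dx = ∫ h(x) ρ(x+y) dx`
    have e3 : ∫ x, h (x - y) * weight σ x = ∫ x, h x * weight σ (x + y) := by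
      have := integral_add_right_eq_self (μ := (volume : Measure E)) (fun x => h (x - y) * weight σ x) y
      simp only [add_sub_cancel_right] at this
      exact this.symm
    rw [e3]
    have iρy : Integrable (fun x : E => weight σ (x + y)) := iρ.comp_add_right y
    have i_lhs : Integrable (fun x => h x * weight σ (x + y)) := by
      refine (iρy.const_mul H).mono'
        (hc.aestronglyMeasurable.mul (continuous_weight.comp (continuous_id.add continuous_const)).aestronglyMeasurable)
        (Eventually.of_forall fun x => ?_)
      rw [Real.norm_eq_abs, abs_mul, abs_of_pos (ρ0 _)]
      exact mul_le_mul_of_nonneg_right (hHabs x) (ρ0 _).le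
    have i_rhs : Integrable (fun x => h x * weight σ x) := by
      refine (iρ.const_mul H).mono' (hc.aestronglyMeasurable.mul continuous_weight.aestronglyMeasurable)
        (Eventually.of_forall fun x => ?_)
      rw [Real.norm_eq_abs, abs_mul, abs_of_pos (ρ0 _)]
      exact mul_le_mul_of_nonneg_right (hHabs x) (ρ0 _).le
    calc ∫ x, h x * weight σ (x + y) ≤ ∫ x, (1 + ‖y‖ ^ 2) ^ 2 * 4 * (h x * weight σ x) := by
          refine integral_mono i_lhs (i_rhs.const_mul _) fun x => ?_
          have := mul_le_mul_of_nonneg_left (weight_add_le hσ x y) (h0 x)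
          calc h x * weight σ (x + y) ≤ h x * (4 * (1 + ‖y‖ ^ 2) ^ 2 * weight σ x) := this
            _ = (1 + ‖y‖ ^ 2) ^ 2 * 4 * (h x * weight σ x) := by ring
      _ = (1 + ‖y‖ ^ 2) ^ 2 * (4 * I) := by rw [integral_const_mul, hI]; ring
  -- integrate the pointwise bound in `y`
  have i_out : Integrable (fun y => ∫ x, G (x, y)) := hGi.integral_prod_right
  calc ∫ y, ∫ x, G (x, y) ≤ ∫ y, |R y| * (1 + ‖y‖ ^ 2) ^ 2 * (4 * I) :=
        integral_mono i_out (hRm.mul_const _) hinner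
    _ = 4 * (∫ y, |R y| * (1 + ‖y‖ ^ 2) ^ 2) * I := by rw [integral_mul_const]; ring

/-- **THE REVERSE INEQUALITY FOR ONE KERNEL**: for `R ∈ L¹` with finite `(1+‖y‖²)²`-moment `M_R`, `g` bounded continuous,
`σ ≥ 1`, `dim E < 4`:  `∫ (∫ R(y) g(x−y) dy)² ρ_σ(x) dx ≤ 4 ‖R‖₁ M_R ∫ g² ρ_σ`. [folklore] -/
theorem integral_convSq_mul_weight_le {σ : ℝ} (hσ : 1 ≤ σ) (hE : Module.finrank ℝ E < 4) {R g : E → ℝ}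
    (hR : Integrable R) (hRm : Integrable fun y => |R y| * (1 + ‖y‖ ^ 2) ^ 2) (hg : Continuous g)
    {K : ℝ} (hK : ∀ x, |g x| ≤ K) :
    ∫ x, (∫ y, R y * g (x - y)) ^ 2 * weight σ x ≤
      4 * (∫ y, |R y|) * (∫ y, |R y| * (1 + ‖y‖ ^ 2) ^ 2) * ∫ x, g x ^ 2 * weight σ x := by
  have hσ0 : 0 < σ := lt_of_lt_of_le one_pos hσ
  have iρ : Integrable (weight (E := E) σ) := integrable_weight hσ0 hE
  have ρ0 : ∀ x : E, 0 < weight σ x := weight_pos σ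
  have hA0 : 0 ≤ ∫ y, |R y| := integral_nonneg fun y => abs_nonneg _
  -- pointwise Cauchy–Schwarz
  have hpt : ∀ x, (∫ y, R y * g (x - y)) ^ 2 * weight σ x ≤
      (∫ y, |R y|) * ((∫ y, |R y| * g (x - y) ^ 2) * weight σ x) := by
    intro x
    have h := sq_integral_mul_le (μ := (volume : Measure E)) (k := fun y => g (x - y)) hR
      ((hg.comp (continuous_const.sub continuous_id)).aestronglyMeasurable) (K := K) (fun y => hK _)
    have := mul_le_mul_of_nonneg_right h (ρ0 x).le
    calc (∫ y, R y * g (x - y)) ^ 2 * weight σ x ≤ ((∫ y, |R y|) * ∫ y, |R y| * g (x - y) ^ 2) * weight σ x := this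
      _ = (∫ y, |R y|) * ((∫ y, |R y| * g (x - y) ^ 2) * weight σ x) := by ring
  -- Tonelli + Peetre with `h = g²`
  have hT := integral_integral_kernel_mul_weight_le hσ hE (h := fun x => g x ^ 2) hR hRm (hg.pow 2)
    (fun x => sq_nonneg _) (H := K ^ 2) (fun x => by
      have := hK x
      rw [← sq_abs]; exact pow_le_pow_left₀ (abs_nonneg _) this 2)
  -- integrability of both sides of the pointwise bound
  have hmeas_conv : ∀ {k : E → ℝ}, Continuous k → (∀ x, |k x| ≤ K ^ 2) →
      Integrable (fun x => (∫ y, |R y| * k (x - y)) * weight σ x) := by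
    intro k hk hkK
    -- `x ↦ ∫ |R y| k(x−y)` is bounded by `K² ‖R‖₁` and measurable (Fubini)
    set G : E × E → ℝ := fun p => |R p.2| * k (p.1 - p.2) * weight σ p.1 with hG
    have hRabs : AEStronglyMeasurable (fun y => |R y|) (volume : Measure E) := hR.abs.aestronglyMeasurable
    have hGm : AEStronglyMeasurable G ((volume : Measure E).prod volume) :=
      ((hRabs.comp_snd (μ := (volume : Measure E))).mul
        (hk.comp (continuous_fst.sub continuous_snd)).aestronglyMeasurable).mul
        (continuous_weight.comp continuous_fst).aestronglyMeasurable
    have hGi : Integrable G (volume.prod volume) := by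
      have hprod : Integrable (fun p : E × E => weight σ p.1 * |R p.2|) (volume.prod volume) :=
        iρ.mul_prod hR.abs
      refine (hprod.const_mul (K ^ 2)).mono' hGm (Eventually.of_forall fun p => ?_)
      rw [Real.norm_eq_abs, hG]
      simp only [abs_mul, abs_abs, abs_of_pos (ρ0 _)]
      calc |R p.2| * |k (p.1 - p.2)| * weight σ p.1 ≤ |R p.2| * K ^ 2 * weight σ p.1 :=
            mul_le_mul_of_nonneg_right (mul_le_mul_of_nonneg_left (hkK _) (abs_nonneg _)) (ρ0 _).le
        _ = K ^ 2 * (weight σ p.1 * |R p.2|) := by ring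
    have e : (fun x => (∫ y, |R y| * k (x - y)) * weight σ x) = fun x => ∫ y, G (x, y) := by
      funext x; rw [← integral_mul_const]
    rw [e]
    exact hGi.integral_prod_left
  have i_rhs : Integrable (fun x => (∫ y, |R y| * g (x - y) ^ 2) * weight σ x) :=
    hmeas_conv (k := fun x => g x ^ 2) (hg.pow 2) (fun x => by
      rw [abs_pow, sq_abs, ← sq_abs]; exact pow_le_pow_left₀ (abs_nonneg _) (hK x) 2)
  have i_lhs : Integrable (fun x => (∫ y, R y * g (x - y)) ^ 2 * weight σ x) := by
    refine (i_rhs.const_mul (∫ y, |R y|)).mono' ?_ (Eventually.of_forall fun x => ?_)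
    · -- measurability of `x ↦ ∫ R(y) g(x−y) dy`: it is the `x`-section integral of an integrable product function
      set G' : E × E → ℝ := fun p => R p.2 * g (p.1 - p.2) with hG'
      have hG'i : Integrable (fun p : E × E => (R p.2 * g (p.1 - p.2)) * weight σ p.1) (volume.prod volume) := by
        have hprod : Integrable (fun p : E × E => weight σ p.1 * |R p.2|) (volume.prod volume) := iρ.mul_prod hR.abs
        refine (hprod.const_mul K).mono'
          (((hR.aestronglyMeasurable.comp_snd (μ := (volume : Measure E))).mul
              (hg.comp (continuous_fst.sub continuous_snd)).aestronglyMeasurable).mul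
            (continuous_weight.comp continuous_fst).aestronglyMeasurable)
          (Eventually.of_forall fun p => ?_)
        rw [Real.norm_eq_abs]
        simp only [abs_mul, abs_of_pos (ρ0 _)]
        calc |R p.2| * |g (p.1 - p.2)| * weight σ p.1 ≤ |R p.2| * K * weight σ p.1 :=
              mul_le_mul_of_nonneg_right (mul_le_mul_of_nonneg_left (hK _) (abs_nonneg _)) (ρ0 _).le
          _ = K * (weight σ p.1 * |R p.2|) := by ring
      have hsec : AEStronglyMeasurable (fun x => ∫ y, R y * g (x - y) * weight σ x) volume :=
        (hG'i.integral_prod_left).aestronglyMeasurable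
      have e : (fun x => ∫ y, R y * g (x - y)) = fun x => (∫ y, R y * g (x - y) * weight σ x) * (weight σ x)⁻¹ := by
        funext x
        rw [integral_mul_const, mul_assoc, mul_inv_cancel₀ (ρ0 x).ne', mul_one]
      have hconv : AEStronglyMeasurable (fun x => ∫ y, R y * g (x - y)) volume := by
        rw [e]
        exact hsec.mul (continuous_weight.measurable.inv).aestronglyMeasurable
      exact (hconv.pow 2).mul continuous_weight.aestronglyMeasurable
    · rw [Real.norm_eq_abs, abs_mul, abs_of_pos (ρ0 x), abs_pow, sq_abs]
      exact hpt x
  calc ∫ x, (∫ y, R y * g (x - y)) ^ 2 * weight σ x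
      ≤ ∫ x, (∫ y, |R y|) * ((∫ y, |R y| * g (x - y) ^ 2) * weight σ x) := integral_mono i_lhs (i_rhs.const_mul _) hpt
    _ = (∫ y, |R y|) * ∫ x, (∫ y, |R y| * g (x - y) ^ 2) * weight σ x := integral_const_mul _ _
    _ ≤ (∫ y, |R y|) * (4 * (∫ y, |R y| * (1 + ‖y‖ ^ 2) ^ 2) * ∫ x, g x ^ 2 * weight σ x) :=
        mul_le_mul_of_nonneg_left hT hA0
    _ = 4 * (∫ y, |R y|) * (∫ y, |R y| * (1 + ‖y‖ ^ 2) ^ 2) * ∫ x, g x ^ 2 * weight σ x := by ring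

end Tonelli

end Summit.NavierStokesRegularity.NavierStokesRegularity.Theorems.PoloidalWindowDoorPoloidalWindowRigidityWeightedYoung
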